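import Summits.Ventures.HSemireg.Pad4TowerFCCoreParitySeam

/-!
# Venture HSemireg — PAD-4 on 𝔅(μ₄): CLEAN CELLS AND FC ORBITS — «clean» ⟺ «no partial SIGN FLIP» (bc5-plan g6's definition (2) of
# LINE 4's windows, the E10 ∕ X∞(μ₄) exposure, as a kernel equivalence), the parity weight is `⟨Δ²⟩ × S₄`-invariant and `Δ`-complemented,
# and the ORBIT FORMS of LEMMA FC-CORE §1b: an (A1)-feasible support needs fully charged classes in ≥ 3 (even core) ∕ ≥ 2 (odd core)
# distinct `⟨Δ²⟩ × S₄`-orbits (RESULT 15 (3)) and in ≥ 2 distinct `G₁ = ⟨Δ⟩ × S₄`-orbits, of weight types {0,4} and {2} (even core; RESULT 14)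

HONEST FRAMING. Lean index of the computation cell `pub-hsemireg` (S4-PUSH, H2 door PAD-4), typed by the Ventures-side typer
`hodge-lit-semireg-typer-2` (g5; line of record stmt-HodgeConjecture-18881 `Cruxes/BlochSeedDiscOne/Lines/birth.lean` 814a6a70c14e831a,
stub `stub_rung_pad4_seedAt`, screen (H1) = the class condition (A1)). Eleventh file of the KERNEL LEMMA Ψ ⊂ (A1) set; sequel of (H)
`Pad4TowerPhaseTorus` (clean lattice), (I) `Pad4TowerDelta2Window` (Δ²), (J) `Pad4TowerFCCoreParitySeam` (parity weights an (A1)-feasible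
support must show; Δ² ∕ Δ ∕ S₄ on pattern and signed charge). THIS FILE closes two bookkeeping loops. (1) bc5-plan g6's AUTHOR'S NOD on (H)
(cell INBOX l.32105 (2)) phrases «clean» as «H ≤ T and H ∩ {0,2}⁴ ⊆ {0, (2,2,2,2)} (no PARTIAL sign flip — the move E10 ∕ X∞(μ₄) kills, cf.
(2,0,0,2) from ⟨γ, S₄⟩)» and states it «EQUIVALENT to» (H)'s `IsPartial`-free definition «(a non-zero element with a zero coordinate squares
to a partial flip or is one)»; here that equivalence is a kernel theorem. (2) gs-eng-2 g51's ORBIT FORMS of LEMMA FC-CORE — RESULT 14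
(l.31979: «a G₁-orbit of an FC class meets all parity patterns of the two complementary weights … ⇒ even core: ≥ 1 FC orbit of weight type
{0,4} … AND ≥ 1 of type {2} …; odd core: ≥ 1 FC orbit of type {1,3}») and RESULT 15 (3) (l.32053: «⟨Δ²⟩×S₄: an orbit covers all patterns of
ONE weight |ρ| (no complementing!) ⇒ even core needs ≥ 3 FC orbits (weight 0 …, weight 2 …, weight 4 …), odd core ≥ 2 (weight 1 …, weight
3 …)») — typed at CLASS level WITHOUT the sign refinements (flag): the parity weight `|ρ|` is invariant under `⟨Δ²⟩ × S₄` and goes to `4 − |ρ|`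
under `Δ`, so the weight-presence theorem (J) `parity_weights_of_classScreen` separates the orbits.

CONTENT (all PROVED; no `sorry`; axioms standard).
* §1 `IsPartialFlip η` (`η ∈ {0,2}⁴ ∖ {0, Δ²}`), `isPartial_of_isPartialFlip`, **`partialFlip_of_partial`** (a partial move IS a partial flip or
  DOUBLES to one), `CleanSubFlip H` (bc5-plan's definition (2)), **`cleanSub_iff_cleanSubFlip`**; `flip_probe` ((2,0,0,2), (2,2,0,0)).
* §2 `pwt_pat` (`|ρ(Z)| = Σ_f kbit`), **`MCell.pwt_perm`**, **`MCell.pwt_delta2`** (invariance), `axisCell_delta ∕ _perm ∕ _delta2`, **`MCell.pwt_delta`**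
  (`|ρ(ΔZ)| = 4 − |ρ(Z)|` on axis cells), `MCell.pwt_delta_iterate`.
* §3 ORBIT RELATIONS as explicit finite disjunctions: `D2S4Rel Z W` (`W = σ·Z` or `Δ²σ·Z`), `G1Rel Z W` (`W = Δⁿ σ·Z`, `n < 4`);
  **`pwt_of_d2S4Rel`** (equal weights), **`pwt_of_g1Rel`** (weight `|ρ|` or `4 − |ρ|`).
* §4 THE ORBIT FORMS: **`MConfig.three_d2S4_orbits_of_classScreen`** ((A1) + μ ≠ 0, FC classes axis ⇒ present FC classes `Z₀, Z₂, Z₄` of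
  weights 0, 2, 4, pairwise NOT `⟨Δ²⟩×S₄`-related — or `Z₁, Z₃` of weights 1, 3, not related), **`MConfig.two_g1_orbits_of_classScreen`** (even
  core: present FC `Z₀` (weight 0, type {0,4}) and `Z₂` (weight 2) NOT `G₁`-related; odd core: a present FC class of weight 1), and the
  contrapositive **`MConfig.not_classScreen_of_one_g1_orbit_even`**: if all present FC classes are `G₁`-related to ONE class of even weight,
  no multiplicity vector has (A1) ∧ μ ≠ 0 (the ◇₈ no-Ψ witness: ONE G₁-orbit `P[6I+ℓ_ζ]⁴`).
* §5 probes (`decide`).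

WHAT IS NOT HERE ∕ NOT IN LEAN. The SIGN refinements of RESULT 14 ∕ 15 (3) (orbit signs `± sign Re μ`), Burnside counts, encoders, SAT
verdicts, the (H1) LP; E10 ∕ X∞(μ₄) themselves (the partial flips are only NAMED here as the excluded moves; their kills are `Pad4TowerXInfMu4` ∕
the E10 census entry). The frame's identification with `H^{ev}(S⁴)` stays the cell's pencil modelling sentence. No variety, sheaf, σ, seed or
abelian variety; NOTHING HERE SAYS THAT HC ∕ HC_CM ∕ HC_AV ∕ W₆ ∕ HC_Kum4Type HOLDS OR FAILS. No `instance`, no notation, no named fact, 0 `sorry`.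

SOURCES (sha16 ∕ bus): bc5-plan g6 NOD l.32105 (2) ∕ l.32109; gs-eng-2 g51 RESULT 14 l.31979, RESULT 15 (3) l.32053, l.32088; card `birth-v4.md`
v4.15 96eae72e810e9d81 rows W14c ∕ W14d; tree (H) 69c8e5181a1acf05 (p608476), (I) 0632296b53fe8b07 (p610008), (J) 7425de8587204214, (G)
`Pad4TowerPermWindow` (p605333), (F) `Pad4TowerFCCoreSeam` (p603640).
-/

namespace Summit.Ventures.HSemireg.Pad4Tower

open Finset

/-! ## §1 «Clean» ⟺ «no partial sign flip» (bc5-plan g6's definition (2)) -/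

/-- a PARTIAL SIGN FLIP: `η ∈ {0,2}⁴` other than `0` and `Δ² = (2,2,2,2)` — `β_f ↦ −β_f` on some but not all factors (the exposure move
of E10 ∕ SAFE2 ∕ X∞(μ₄); e.g. `(2,0,0,2)`). Decidable. -/
abbrev IsPartialFlip (η : PVec) : Prop := (∀ f, η f = 0 ∨ η f = 2) ∧ η ≠ 0 ∧ η ≠ d2Vec

set_option synthInstance.maxSize 8192 in -- nested decidable implications
/-- a partial sign flip is a partial phase move. [kernel, `decide`] -/
theorem isPartial_of_isPartialFlip : ∀ η : PVec, IsPartialFlip η → IsPartial η := by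
  decide +kernel

set_option synthInstance.maxSize 8192 in -- nested decidable implications
/-- **A PARTIAL PHASE MOVE IS A PARTIAL SIGN FLIP OR DOUBLES TO ONE** («a non-zero element with a zero coordinate squares to a partial
flip or is one», bc5-plan g6 l.32109). [kernel, `decide` over all 256 vectors] -/
theorem partialFlip_of_partial : ∀ η : PVec, IsPartial η → IsPartialFlip η ∨ IsPartialFlip (η + η) := by
  decide +kernel

/-- bc5-plan g6's DEFINITION (2) of a clean window (l.32105): a subgroup of `T` (finite, contains `0`, closed under `+`) with
`H ∩ {0,2}⁴ ⊆ {0, (2,2,2,2)}` — NO PARTIAL SIGN FLIP. -/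
def CleanSubFlip (H : Finset PVec) : Prop :=
  0 ∈ H ∧ (∀ a ∈ H, ∀ b ∈ H, a + b ∈ H) ∧ (∀ a ∈ H, DetOne a) ∧ ∀ a ∈ H, ¬ IsPartialFlip a

/-- **THE TWO DEFINITIONS OF «CLEAN» AGREE** ((H)'s `CleanSub` = no partial phase move; bc5-plan's = no partial sign flip): for subgroups
the two exclusions coincide, because a subgroup containing a partial move `η` also contains `2η`. -/
theorem cleanSub_iff_cleanSubFlip (H : Finset PVec) : CleanSub H ↔ CleanSubFlip H := by
  constructor
  · rintro ⟨h0, hadd, hdet, hnp⟩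
    exact ⟨h0, hadd, hdet, fun a ha hf => hnp a ha (isPartial_of_isPartialFlip a hf)⟩
  · rintro ⟨h0, hadd, hdet, hnf⟩
    refine ⟨h0, hadd, hdet, fun a ha hp => ?_⟩
    rcases partialFlip_of_partial a hp with h | h
    · exact hnf a ha h
    · exact hnf _ (hadd a ha a ha) h

/-- hence bc5-plan's clean subgroups are the same six, with `Δ²` in every non-trivial one. -/
theorem cleanSubFlip_classification {H : Finset PVec} (hH : CleanSubFlip H) :
    (H = trivSub ∨ H = d2Sub ∨ H = dSub ∨ H = gSub 0 ∨ H = gSub 1 ∨ H = gSub 2) ∧ (H ≠ trivSub → d2Sub ⊆ H) :=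
  have h := (cleanSub_iff_cleanSubFlip H).2 hH
  ⟨cleanSub_classification h, d2Sub_subset_of_cleanSub h⟩

/-- `(2,0,0,2)` (bc5-plan's example from `⟨γ, S₄⟩`: `γ₁ + (γ₁ with slots 1,3 swapped) = (1,1,3,3) + (1,3,3,1) = (2,0,2,0)`-type) and
`Δ + γ₁ = (2,2,0,0)` are partial sign flips; `Δ²` and `0` are not; `(1,3,0,0)` is partial but not a flip — its double `(2,2,0,0)` is. [`decide`] -/
theorem flip_probe :
    IsPartialFlip (pv 2 0 0 2) ∧ IsPartialFlip (dVec + gVec 0) ∧ gVec 0 + permP (Equiv.swap 1 3) (gVec 0) = pv 2 0 2 0 ∧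
      ¬ IsPartialFlip d2Vec ∧ ¬ IsPartialFlip 0 ∧ (IsPartial (pv 1 3 0 0) ∧ ¬ IsPartialFlip (pv 1 3 0 0) ∧
        IsPartialFlip (pv 1 3 0 0 + pv 1 3 0 0)) := by
  decide

/-! ## §2 The parity weight under S₄, Δ², Δ -/

/-- the parity weight of a cell is the number of its imaginary-phase factors. -/
theorem pwt_pat (Z : MCell) : pwt Z.pat = kbit (Z 0) + kbit (Z 1) + kbit (Z 2) + kbit (Z 3) := by
  simp only [pwt, bitOf_pat]

/-- **the parity weight is S₄-INVARIANT**. -/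
theorem MCell.pwt_perm (σ : Equiv.Perm (Fin 4)) (Z : MCell) : pwt (Z.perm σ).pat = pwt Z.pat := by
  rw [pwt_pat, pwt_pat]
  simp only [MCell.perm_apply]
  have e : ∀ W : MCell, kbit (W 0) + kbit (W 1) + kbit (W 2) + kbit (W 3) = ∑ f, kbit (W f) := fun W => by
    simp [Fin.sum_univ_four]
  rw [show kbit (Z (σ 0)) + kbit (Z (σ 1)) + kbit (Z (σ 2)) + kbit (Z (σ 3)) = ∑ f, kbit (Z (σ f)) by simp [Fin.sum_univ_four], e Z]
  exact Equiv.sum_comp σ (fun f => kbit (Z f))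

/-- **the parity weight is Δ²-INVARIANT**. -/
theorem MCell.pwt_delta2 (Z : MCell) : pwt Z.delta2.pat = pwt Z.pat := by
  rw [MCell.pat_delta2]

/-- Δ, Δ² and the factor permutations preserve axis cells. -/
theorem axisCell_delta_perm_delta2 (Z : MCell) (hZ : AxisCell Z) (σ : Equiv.Perm (Fin 4)) :
    AxisCell Z.delta ∧ AxisCell (Z.perm σ) ∧ AxisCell Z.delta2 := by
  refine ⟨fun f => ?_, fun f => hZ (σ f), (Z.fcc_axis_delta2.2).2 hZ⟩
  rcases hZ f with ⟨h1, h2⟩ | ⟨h1, h2⟩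
  · exact Or.inr ⟨by simp [MCell.delta, deltaPt, h2], by simpa [MCell.delta, deltaPt] using h1⟩
  · exact Or.inl ⟨by simpa [MCell.delta, deltaPt] using h2, by simp [MCell.delta, deltaPt, h1]⟩

/-- **Δ COMPLEMENTS THE PARITY WEIGHT** on axis cells: `|ρ(ΔZ)| = 4 − |ρ(Z)|` (RESULT 10 ∕ W14: «Δ maps ρ to its complement»). -/
theorem MCell.pwt_delta (Z : MCell) (hZ : AxisCell Z) : pwt Z.delta.pat = 4 - pwt Z.pat := by
  have hb : ∀ f, bitOf Z.delta.pat f = 1 - bitOf Z.pat f := Z.bitOf_pat_delta hZ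
  have hle : ∀ f, bitOf Z.pat f ≤ 1 := fun f => by rw [bitOf_pat]; exact kbit_le_one _
  have h0 := hb 0; have h1 := hb 1; have h2 := hb 2; have h3 := hb 3
  have l0 := hle 0; have l1 := hle 1; have l2 := hle 2; have l3 := hle 3
  unfold pwt
  omega

/-- iterating Δ: the weight stays `|ρ|` or becomes `4 − |ρ|`, and axis-ness is kept. -/
theorem MCell.pwt_delta_iterate (n : ℕ) : ∀ Z : MCell, AxisCell Z →
    AxisCell (MCell.delta^[n] Z) ∧ (pwt (MCell.delta^[n] Z).pat = pwt Z.pat ∨ pwt (MCell.delta^[n] Z).pat = 4 - pwt Z.pat) := by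
  induction n with
  | zero => intro Z hZ; exact ⟨hZ, Or.inl rfl⟩
  | succ n ih =>
    intro Z hZ
    obtain ⟨hax, hw⟩ := ih Z hZ
    rw [Function.iterate_succ_apply']
    refine ⟨(axisCell_delta_perm_delta2 _ hax 1).1, ?_⟩
    have hd := MCell.pwt_delta _ hax
    have hle : pwt Z.pat ≤ 4 := by
      have := fun f => (bitOf_pat Z f ▸ kbit_le_one (Z f) : bitOf Z.pat f ≤ 1)
      have t0 := this 0; have t1 := this 1; have t2 := this 2; have t3 := this 3
      unfold pwt; omega
    rcases hw with h | h <;> omega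

/-! ## §3 Orbit relations under `⟨Δ²⟩ × S₄` and `G₁ = ⟨Δ⟩ × S₄` -/

/-- `W` lies in the `⟨Δ²⟩ × S₄`-ORBIT of `Z`: `W = σ·Z` or `W = Δ²(σ·Z)` (48 elements; `Δ²` central). Decidable. -/
def D2S4Rel (Z W : MCell) : Prop := ∃ σ : Equiv.Perm (Fin 4), W = Z.perm σ ∨ W = (Z.perm σ).delta2

/-- `W` lies in the `G₁ = ⟨Δ⟩ × S₄`-ORBIT of `Z`: `W = Δⁿ(σ·Z)`, `n < 4` (96 elements). -/
def G1Rel (Z W : MCell) : Prop := ∃ σ : Equiv.Perm (Fin 4), ∃ n : ℕ, n < 4 ∧ W = MCell.delta^[n] (Z.perm σ)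

/-- the orbit relations are reflexive. -/
theorem d2S4Rel_refl_g1Rel_refl (Z : MCell) : D2S4Rel Z Z ∧ G1Rel Z Z :=
  ⟨⟨1, Or.inl (MCell.perm_one Z).symm⟩, ⟨1, 0, by omega, by simp [MCell.perm_one]⟩⟩

/-- **`⟨Δ²⟩ × S₄`-related classes have EQUAL parity weight** (RESULT 15 (3): «an orbit covers all patterns of ONE weight |ρ| (no complementing!)»). -/
theorem pwt_of_d2S4Rel {Z W : MCell} (h : D2S4Rel Z W) : pwt W.pat = pwt Z.pat := by
  obtain ⟨σ, rfl | rfl⟩ := h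
  · exact Z.pwt_perm σ
  · rw [MCell.pwt_delta2, MCell.pwt_perm]

/-- **`G₁`-related axis classes have parity weights `|ρ|` or `4 − |ρ|`** (RESULT 14: «a G₁-orbit of an FC class meets [only] the parity patterns of
the two complementary weights»). -/
theorem pwt_of_g1Rel {Z W : MCell} (hZ : AxisCell Z) (h : G1Rel Z W) : pwt W.pat = pwt Z.pat ∨ pwt W.pat = 4 - pwt Z.pat := by
  obtain ⟨σ, n, -, rfl⟩ := h
  have hax : AxisCell (Z.perm σ) := (axisCell_delta_perm_delta2 Z hZ σ).2.1
  rcases (MCell.pwt_delta_iterate n (Z.perm σ) hax).2 with h | h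
  · exact Or.inl (h.trans (Z.pwt_perm σ))
  · exact Or.inr (h.trans (by rw [Z.pwt_perm σ]))

/-! ## §4 The orbit forms of LEMMA FC-CORE §1b -/

/-- a present fully charged class of a given parity WEIGHT, from one of a given pattern. -/
theorem MConfig.hasFC_weight (C : MConfig) {κ : Fin 16} (h : C.HasFC κ) :
    ∃ Z, (Z ∈ C.lower ∨ Z ∈ C.upper) ∧ FCc Z ∧ pwt Z.pat = pwt κ := by
  obtain ⟨Z, hZ, hfc, hp⟩ := h
  exact ⟨Z, hZ, hfc, by rw [hp]⟩

/-- **RESULT 15 (3), `⟨Δ²⟩ × S₄` ORBIT FORM (class level, no signs)**: if the fully charged classes are axis cells, (A1) + μ ≠ 0 forces present FC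
classes `Z₀, Z₂, Z₄` of parity weights 0, 2, 4 — pairwise in DIFFERENT `⟨Δ²⟩×S₄`-orbits (≥ 3 FC orbits, even core) — or `Z₁, Z₃` of weights 1, 3 in
different orbits (≥ 2, odd core). -/
theorem MConfig.three_d2S4_orbits_of_classScreen (C : MConfig) (mN mP : MCell → ℤ) (hN : ∀ Z ∈ C.lower, FCc Z → AxisCell Z)
    (hP : ∀ P ∈ C.upper, FCc P → AxisCell P) (hA : ClassScreen (C.wch mN mP)) (hμ : C.wch mN mP eWord ≠ 0) :
    (∃ Z₀ Z₂ Z₄, ((Z₀ ∈ C.lower ∨ Z₀ ∈ C.upper) ∧ FCc Z₀ ∧ pwt Z₀.pat = 0) ∧ ((Z₂ ∈ C.lower ∨ Z₂ ∈ C.upper) ∧ FCc Z₂ ∧ pwt Z₂.pat = 2) ∧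
        ((Z₄ ∈ C.lower ∨ Z₄ ∈ C.upper) ∧ FCc Z₄ ∧ pwt Z₄.pat = 4) ∧ ¬ D2S4Rel Z₀ Z₂ ∧ ¬ D2S4Rel Z₂ Z₄ ∧ ¬ D2S4Rel Z₀ Z₄) ∨
      (∃ Z₁ Z₃, ((Z₁ ∈ C.lower ∨ Z₁ ∈ C.upper) ∧ FCc Z₁ ∧ pwt Z₁.pat = 1) ∧ ((Z₃ ∈ C.lower ∨ Z₃ ∈ C.upper) ∧ FCc Z₃ ∧ pwt Z₃.pat = 3) ∧
        ¬ D2S4Rel Z₁ Z₃) := by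
  obtain ⟨p0, p15, p3, p1, p7, -⟩ := pwt_table
  rcases C.parity_weights_of_classScreen mN mP hN hP hA hμ with ⟨h0, h3, h15⟩ | ⟨h1, h7⟩
  · obtain ⟨Z₀, hZ₀, f0, w0⟩ := C.hasFC_weight h0
    obtain ⟨Z₂, hZ₂, f2, w2⟩ := C.hasFC_weight h3
    obtain ⟨Z₄, hZ₄, f4, w4⟩ := C.hasFC_weight h15
    rw [p0] at w0; rw [p3] at w2; rw [p15] at w4
    refine Or.inl ⟨Z₀, Z₂, Z₄, ⟨hZ₀, f0, w0⟩, ⟨hZ₂, f2, w2⟩, ⟨hZ₄, f4, w4⟩, fun h => ?_, fun h => ?_, fun h => ?_⟩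
    · have := pwt_of_d2S4Rel h; omega
    · have := pwt_of_d2S4Rel h; omega
    · have := pwt_of_d2S4Rel h; omega
  · obtain ⟨Z₁, hZ₁, f1, w1⟩ := C.hasFC_weight h1
    obtain ⟨Z₃, hZ₃, f3, w3⟩ := C.hasFC_weight h7
    rw [p1] at w1; rw [p7] at w3
    refine Or.inr ⟨Z₁, Z₃, ⟨hZ₁, f1, w1⟩, ⟨hZ₃, f3, w3⟩, fun h => ?_⟩
    have := pwt_of_d2S4Rel h; omega

/-- **RESULT 14, `G₁ = ⟨Δ⟩ × S₄` ORBIT FORM (class level, no signs)**: if the fully charged classes are axis cells, (A1) + μ ≠ 0 forces, in the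
even core, a present FC class `Z₀` of weight 0 (orbit type {0,4}) AND a present FC class `Z₂` of weight 2 (type {2}) which is NOT in the
`G₁`-orbit of `Z₀`; in the odd core, a present FC class of weight 1 (type {1,3}). -/
theorem MConfig.two_g1_orbits_of_classScreen (C : MConfig) (mN mP : MCell → ℤ) (hN : ∀ Z ∈ C.lower, FCc Z → AxisCell Z)
    (hP : ∀ P ∈ C.upper, FCc P → AxisCell P) (hA : ClassScreen (C.wch mN mP)) (hμ : C.wch mN mP eWord ≠ 0) :
    (∃ Z₀ Z₂, ((Z₀ ∈ C.lower ∨ Z₀ ∈ C.upper) ∧ FCc Z₀ ∧ pwt Z₀.pat = 0) ∧ ((Z₂ ∈ C.lower ∨ Z₂ ∈ C.upper) ∧ FCc Z₂ ∧ pwt Z₂.pat = 2) ∧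
        ¬ G1Rel Z₀ Z₂) ∨
      (∃ Z₁, (Z₁ ∈ C.lower ∨ Z₁ ∈ C.upper) ∧ FCc Z₁ ∧ pwt Z₁.pat = 1) := by
  obtain ⟨p0, -, p3, p1, -, -⟩ := pwt_table
  rcases C.parity_weights_of_classScreen mN mP hN hP hA hμ with ⟨h0, h3, -⟩ | ⟨h1, -⟩
  · obtain ⟨Z₀, hZ₀, f0, w0⟩ := C.hasFC_weight h0
    obtain ⟨Z₂, hZ₂, f2, w2⟩ := C.hasFC_weight h3
    rw [p0] at w0; rw [p3] at w2
    have hax : AxisCell Z₀ := hZ₀.elim (fun h => hN Z₀ h f0) fun h => hP Z₀ h f0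
    refine Or.inl ⟨Z₀, Z₂, ⟨hZ₀, f0, w0⟩, ⟨hZ₂, f2, w2⟩, fun h => ?_⟩
    rcases pwt_of_g1Rel hax h with h' | h' <;> omega
  · obtain ⟨Z₁, hZ₁, f1, w1⟩ := C.hasFC_weight h1
    rw [p1] at w1
    exact Or.inr ⟨Z₁, hZ₁, f1, w1⟩

/-- **ONE EVEN-TYPE `G₁`-ORBIT OF FULLY CHARGED CLASSES CANNOT CARRY (A1) WITH μ ≠ 0** (the ◇₈ no-Ψ witness of card W14d: FC content ONE
G₁-orbit `P[6I+ℓ_ζ]⁴`, weight type {0,4}): if every present fully charged class is `G₁`-related to one axis class `R` of EVEN parity weight,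
then no multiplicity vector passes the class screen with μ ≠ 0. -/
theorem MConfig.not_classScreen_of_one_g1_orbit_even (C : MConfig) (mN mP : MCell → ℤ) (hN : ∀ Z ∈ C.lower, FCc Z → AxisCell Z)
    (hP : ∀ P ∈ C.upper, FCc P → AxisCell P) (R : MCell) (hR : AxisCell R) (heven : pwt R.pat % 2 = 0)
    (horb : ∀ Z, (Z ∈ C.lower ∨ Z ∈ C.upper) → FCc Z → G1Rel R Z)
    (hA : ClassScreen (C.wch mN mP)) (hμ : C.wch mN mP eWord ≠ 0) : False := by
  rcases C.two_g1_orbits_of_classScreen mN mP hN hP hA hμ with ⟨Z₀, Z₂, ⟨hZ₀, f0, w0⟩, ⟨hZ₂, f2, w2⟩, -⟩ | ⟨Z₁, hZ₁, f1, w1⟩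
  · rcases pwt_of_g1Rel hR (horb Z₀ hZ₀ f0) with a | a <;> rcases pwt_of_g1Rel hR (horb Z₂ hZ₂ f2) with b | b <;> omega
  · rcases pwt_of_g1Rel hR (horb Z₁ hZ₁ f1) with a | a <;> omega

/-! ## §5 Kernel probes -/

/-- the real-phase cell `[ℓ₁|ℓ₁|ℓ₁|ℓ₁]` has parity weight 0, its Δ-image `[ℓ₋ᵢ|…]` weight 4 (same G₁-orbit, complementary weights), the
four-phase cell `fcCell` weight 2; `fcCell` is `⟨Δ²⟩×S₄`-related to its antipode and `G₁`-related to its Δ-image. [kernel, `decide`] -/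
theorem orbit_probe :
    pwt (mcellOf (lpt 1 0) (lpt 1 0) (lpt 1 0) (lpt 1 0)).pat = 0 ∧ pwt (mcellOf (lpt 1 0) (lpt 1 0) (lpt 1 0) (lpt 1 0)).delta.pat = 4 ∧
      pwt fcCell.pat = 2 ∧ pwt fcCell.delta.pat = 2 ∧ fcCell.delta2 = (fcCell.perm 1).delta2 ∧
      fcCell.delta = MCell.delta^[1] (fcCell.perm 1) := by
  refine ⟨by decide +kernel, by decide +kernel, by decide +kernel, by decide +kernel, rfl, rfl⟩

end Summit.Ventures.HSemireg.Pad4Tower
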